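import Mathlib.Analysis.SpecialFunctions.Pow.Real
import Mathlib.Analysis.SpecialFunctions.Exponential
import Mathlib.Analysis.SpecialFunctions.Log.Basic
import Mathlib.Analysis.Complex.ExponentialBounds
import Mathlib.Analysis.Real.Pi.Bounds
import HarnessLib

/-!
# HANDOFF — ASYMPTOTICS (D): the profile-control constant `κ ≥ 1/2` (rh-explicit, track «HANDOFF», seat prove-2 gen10, ATTEMPT-19 §8 (P5))

HONEST FRAMING. Nothing here bears on the truth of RH; elementary real inequalities (Mathlib only). In ABSTRACT variables
(`T = T′`, `k = k′`, `pL`, `W`, with the sizes proved in part (B) taken as hypotheses: `e^{2b} ≤ T`, `T² ≤ W ≤ 1.01T²`,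
`2 ≤ k ≤ (2/5)bT`, `T³/(10π) ≤ pL`) and the programme's choices `y = (3/5)L^{3/2}`, `N₁ = 4⌈L⌉`, `2b ≤ L ≤ 2b+1`, `b ≥ 100`,
we prove the conditions of `dodger_witness_explicit` on the profile-control constants:
`N₁+1 ≤ pL/(2W)`, `ρ₁ ≤ 1/3`, `ρ₂ ≤ 1/55 ≤ e^{-2}`, `η ≤ 2/25`, `τ₁ ≤ 1/100`, `τ₂ ≤ 1/100`, hence **`κ ≥ 1/2`**.
No `sorry`, standard axioms.

References: this track (ATTEMPT-16 §5 Lemma D1; ATTEMPT-19 §8 (P5)).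
-/

set_option linter.dupNamespace false

noncomputable section

open Real

namespace Summit.RiemannHypothesis.RiemannHypothesis.Theorems.Handoff

/-- **Master size of the horizon.** `b ≥ 100`, `e^{2b} ≤ T` ⟹ `110000(b+1)² ≤ T` (from `x⁶/720 ≤ eˣ`). [this track, ATTEMPT-19 §8] -/
theorem horizon_master {b T : ℝ} (hb : 100 ≤ b) (hTe : Real.exp (2 * b) ≤ T) : 110000 * (b + 1) ^ 2 ≤ T := by
  have h6 : (2 * b) ^ 6 / 720 ≤ Real.exp (2 * b) := by
    have := Real.pow_div_factorial_le_exp (2 * b) (by linarith) 6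
    norm_num [Nat.factorial] at this; exact this
  have hb2 : (10000 : ℝ) ≤ b ^ 2 := by nlinarith only [hb]
  have hb4 : (10000 : ℝ) ^ 2 ≤ b ^ 4 := by nlinarith only [hb2]
  have h46 := mul_le_mul_of_nonneg_right hb4 (by positivity : (0 : ℝ) ≤ b ^ 2)
  have : 110000 * (b + 1) ^ 2 ≤ (2 * b) ^ 6 / 720 := by
    have e : (2 * b) ^ 6 / 720 = 4 / 45 * (b ^ 4 * b ^ 2) := by ring
    rw [e]; nlinarith only [hb2, h46, hb]
  linarith only [this, h6, hTe]

/-- Numerics: `7.38 < e² < 7.39`, `54 < e⁴ < 54.6`. [folklore] -/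
theorem exp_numerics : Real.exp 2 < 7.39 ∧ 7.38 < Real.exp 2 ∧ Real.exp 4 < 54.6 ∧ 54 < Real.exp 4 := by
  have h2 : Real.exp 2 = Real.exp 1 ^ 2 := by exact_mod_cast (Real.exp_one_pow 2).symm
  have h4 : Real.exp 4 = Real.exp 1 ^ 4 := by exact_mod_cast (Real.exp_one_pow 4).symm
  have hlt := Real.exp_one_lt_d9
  have hgt := Real.exp_one_gt_d9
  have h0 := Real.exp_pos 1
  have a : Real.exp 1 ^ 2 < 2.7182818286 ^ 2 := by nlinarith only [hlt, h0]
  have b : 2.7182818283 ^ 2 < Real.exp 1 ^ 2 := by nlinarith only [hgt]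
  refine ⟨?_, ?_, ?_, ?_⟩
  · rw [h2]; nlinarith only [a]
  · rw [h2]; nlinarith only [b]
  · rw [h4]; nlinarith only [a, pow_pos h0 2]
  · rw [h4]; nlinarith only [b]

/-- `ν = k(T+½)/pL ≤ 1/100`. [this track, ATTEMPT-19 §8 (P5)] -/
theorem nu_le {b T k pL : ℝ} (hb : 100 ≤ b) (hT : 110000 * (b + 1) ^ 2 ≤ T) (hk : k ≤ 2 / 5 * b * T)
    (hpL : T ^ 3 / 31.42 ≤ pL) : k * (T + 1 / 2) / pL ≤ 1 / 100 := by
  have hT0 : 0 < T := by nlinarith only [hb, hT]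
  have hT50 : 50 ≤ T := by nlinarith only [hb, hT]
  have hpL0 : 0 < pL := lt_of_lt_of_le (by positivity) hpL
  rw [div_le_iff₀ hpL0]
  have h1 : k * (T + 1 / 2) ≤ 2 / 5 * b * T * (101 / 100 * T) :=
    mul_le_mul hk (by linarith only [hT50]) (by linarith only [hT0]) (by positivity)
  have h2 : 2 / 5 * b * (101 / 100) * 3142 ≤ T := by nlinarith only [hT, hb]
  have h3 := mul_le_mul_of_nonneg_right h2 (sq_nonneg T)
  have h4 : T ^ 3 ≤ 31.42 * pL := by rw [div_le_iff₀ (by norm_num)] at hpL; linarith only [hpL]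
  nlinarith only [h1, h3, h4]

/-- `N₁ + 1 ≤ pL/(2W)`. [this track, ATTEMPT-19 §8 (P5)] -/
theorem N_le {b L T pL W : ℝ} {N₁ : ℕ} (hb : 100 ≤ b) (hL2 : L ≤ 2 * b + 1) (hT : 110000 * (b + 1) ^ 2 ≤ T)
    (hW0 : 0 < W) (hW2 : W ≤ 101 / 100 * T ^ 2) (hpL : T ^ 3 / 31.42 ≤ pL) (hN₁le : (N₁ : ℝ) ≤ 4 * L + 4) :
    (N₁ : ℝ) + 1 ≤ pL / (2 * W) := by
  have hT0 : 0 < T := by nlinarith only [hb, hT]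
  rw [le_div_iff₀ (by positivity)]
  have hL5 : 0 ≤ 4 * L + 5 := by
    have : (0 : ℝ) ≤ N₁ := Nat.cast_nonneg _
    linarith only [this, hN₁le]
  have h1 : ((N₁ : ℝ) + 1) * (2 * W) ≤ (4 * L + 5) * (2 * (101 / 100 * T ^ 2)) :=
    mul_le_mul (by linarith only [hN₁le]) (by linarith only [hW2]) (by positivity) hL5
  have h2 : (4 * L + 5) * (2 * (101 / 100)) * 31.42 ≤ T := by nlinarith only [hT, hb, hL2]
  have h3 := mul_le_mul_of_nonneg_right h2 (sq_nonneg T)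
  have h4 : T ^ 3 ≤ 31.42 * pL := by rw [div_le_iff₀ (by norm_num)] at hpL; linarith only [hpL]
  nlinarith only [h1, h3, h4]

/-- `ρ₁ ≤ 1/3`. [this track, ATTEMPT-19 §8 (P5)] -/
theorem rho1_le {L ν lamU ρ1 E : ℝ} {N₁ : ℕ} (hL0 : 0 < L) (hν0 : 0 ≤ ν) (hν : ν ≤ 1 / 100) (hlamU : lamU = 1 + ν)
    (hE : E = Real.exp (3 + lamU)) (hN₁ge : 4 * L ≤ (N₁ : ℝ))
    (hρ1 : ρ1 = E * (4 * (9 / 25 * L ^ 3)) / (4 * ((N₁ : ℝ) + 1) ^ 3)) : ρ1 ≤ 1 / 3 := by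
  have hexp : E ≤ 55.7 := by
    have e1 : 3 + lamU = 4 + ν := by rw [hlamU]; ring
    rw [hE, e1, Real.exp_add]
    have h1 := exp_numerics.2.2.1
    have h2 : Real.exp ν ≤ 1 + 2 * (1 / 100) := by
      have := Real.abs_exp_sub_one_le (x := ν) (by rw [abs_of_nonneg hν0]; linarith only [hν])
      rw [abs_of_nonneg hν0] at this
      have := (abs_le.1 this).2
      linarith only [this, hν]
    calc Real.exp 4 * Real.exp ν ≤ 54.6 * (1 + 2 * (1 / 100)) :=
          mul_le_mul h1.le h2 (Real.exp_pos _).le (by norm_num)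
      _ ≤ 55.7 := by norm_num
  have hE0 : 0 ≤ E := by rw [hE]; exact (Real.exp_pos _).le
  have hNp : 0 < (N₁ : ℝ) + 1 := by linarith only [hN₁ge, hL0]
  rw [hρ1, div_le_iff₀ (by positivity)]
  have h1 : (4 * L) ^ 3 ≤ ((N₁ : ℝ) + 1) ^ 3 := pow_le_pow_left₀ (by positivity) (by linarith only [hN₁ge]) 3
  have h2 : E * (4 * (9 / 25 * L ^ 3)) ≤ 55.7 * (4 * (9 / 25 * L ^ 3)) :=
    mul_le_mul_of_nonneg_right hexp (by positivity)
  nlinarith only [h1, h2, pow_pos hL0 3]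

/-- `τ₁ ≤ 1/100`. [this track, ATTEMPT-19 §8 (P5)] -/
theorem tau1_le {ρ1 τ1 : ℝ} {N₁ : ℕ} (hρ1ge : 0 ≤ ρ1) (hρ1le : ρ1 ≤ 1 / 3) (h5 : 5 ≤ N₁ + 1)
    (hτ1 : τ1 = ρ1 ^ (N₁ + 1) / (1 - ρ1)) : τ1 ≤ 1 / 100 := by
  rw [hτ1, div_le_iff₀ (by linarith only [hρ1le])]
  have h1 : ρ1 ^ (N₁ + 1) ≤ ρ1 ^ 5 := pow_le_pow_of_le_one hρ1ge (by linarith only [hρ1le]) h5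
  have h2 : ρ1 ^ 5 ≤ (1 / 3) ^ 5 := pow_le_pow_left₀ hρ1ge hρ1le 5
  nlinarith only [h1, h2, hρ1le]

/-- `ρ₂ ≤ 1/55`. [this track, ATTEMPT-19 §8 (P5)] -/
theorem rho2_le {b L T pL W ρ2U : ℝ} (hb : 100 ≤ b) (hL0 : 0 < L) (hL2 : L ≤ 2 * b + 1) (hT : 110000 * (b + 1) ^ 2 ≤ T)
    (hW0 : 0 < W) (hW2 : W ≤ 101 / 100 * T ^ 2) (hpL : T ^ 3 / 31.42 ≤ pL)
    (hρ2U : ρ2U = 8 * Real.exp 2 * W ^ 3 * (9 / 25 * L ^ 3) / pL ^ 3) : ρ2U ≤ 1 / 55 := by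
  have hT0 : 0 < T := by nlinarith only [hb, hT]
  have hpL0 : 0 < pL := lt_of_lt_of_le (by positivity) hpL
  have hLT : 340 * L ≤ T := by nlinarith only [hT, hb, hL2]
  rw [hρ2U, div_le_iff₀ (by positivity)]
  have hW3 : W ^ 3 ≤ (101 / 100 * T ^ 2) ^ 3 := pow_le_pow_left₀ hW0.le hW2 3
  have hp3 : (T ^ 3 / 31.42) ^ 3 ≤ pL ^ 3 := pow_le_pow_left₀ (by positivity) hpL 3
  have hL3 : (340 * L) ^ 3 ≤ T ^ 3 := pow_le_pow_left₀ (by positivity) hLT 3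
  have e2 := exp_numerics.1
  have hT6 : (0 : ℝ) ≤ T ^ 6 := by positivity
  have hL3' : 0 < 9 / 25 * L ^ 3 := by positivity
  have h1 : 8 * Real.exp 2 * W ^ 3 * (9 / 25 * L ^ 3) ≤ 8 * 7.39 * (101 / 100 * T ^ 2) ^ 3 * (9 / 25 * L ^ 3) := by
    have := mul_le_mul e2.le hW3 (by positivity) (by norm_num)
    nlinarith only [this, hL3']
  have h2 : 8 * 7.39 * (101 / 100 * T ^ 2) ^ 3 * (9 / 25 * L ^ 3) ≤ 1 / 55 * (T ^ 3 / 31.42) ^ 3 := by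
    have h := mul_le_mul_of_nonneg_left hL3 hT6
    have e1 : (T ^ 3 / 31.42) ^ 3 = T ^ 6 * T ^ 3 / 31.42 ^ 3 := by ring
    have e2 : (101 / 100 * T ^ 2) ^ 3 * (9 / 25 * L ^ 3) = (101 / 100) ^ 3 * (9 / 25) * (T ^ 6 * L ^ 3) := by ring
    rw [e1, mul_assoc, e2]
    have e3 : T ^ 6 * (340 * L) ^ 3 = 340 ^ 3 * (T ^ 6 * L ^ 3) := by ring
    rw [e3] at h
    have hX : 0 ≤ T ^ 6 * L ^ 3 := by positivity
    set X := T ^ 6 * L ^ 3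
    set Y := T ^ 6 * T ^ 3
    norm_num at h ⊢
    linarith only [h, hX]
  nlinarith only [h1, h2, hp3]

/-- `τ₂ ≤ 1/100`. [this track, ATTEMPT-19 §8 (P5)] -/
theorem tau2_le {b T k pL W ρ2U τ2U : ℝ} (hb : 100 ≤ b) (hT : 110000 * (b + 1) ^ 2 ≤ T)
    (hk : k ≤ 2 / 5 * b * T) (hW1 : T ^ 2 ≤ W) (hW2 : W ≤ 101 / 100 * T ^ 2) (hpL : T ^ 3 / 31.42 ≤ pL)
    (hρ2ge : 0 < ρ2U) (hρ2le : ρ2U ≤ 1 / 55)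
    (hτ2U : τ2U = Real.exp (pL / W * (1 + 1 / 2 * Real.log ρ2U) + k * (T + 1 / 2) / (2 * W)) / (1 - ρ2U)) :
    τ2U ≤ 1 / 100 := by
  have hT0 : 0 < T := by nlinarith only [hb, hT]
  have hb0 : 0 < b := by linarith only [hb]
  have hpL0 : 0 < pL := lt_of_lt_of_le (by positivity) hpL
  have hW0 : 0 < W := lt_of_lt_of_le (by positivity) hW1
  rw [hτ2U, div_le_iff₀ (by linarith only [hρ2le])]
  have hlog : Real.log ρ2U ≤ -4 := by
    have h1 : Real.log ρ2U ≤ Real.log (1 / 55) := Real.log_le_log hρ2ge hρ2le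
    have h2 : Real.log (1 / 55) = -Real.log 55 := by rw [one_div, Real.log_inv]
    have h3 : 4 ≤ Real.log 55 := by
      rw [Real.le_log_iff_exp_le (by norm_num)]; exact (exp_numerics.2.2.1.le.trans (by norm_num))
    linarith only [h1, h2, h3]
  have hT50 : 50 ≤ T := by nlinarith only [hb, hT]
  have hpW : T / 31.8 ≤ pL / W := by
    rw [div_le_div_iff₀ (by norm_num) hW0]
    have h1 := mul_le_mul_of_nonneg_left hW2 hT0.le
    have h4 : T ^ 3 ≤ 31.42 * pL := by rw [div_le_iff₀ (by norm_num)] at hpL; linarith only [hpL]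
    nlinarith only [h1, h4, hpL0]
  have hA : pL / W * (1 + 1 / 2 * Real.log ρ2U) ≤ -(T / 31.8) := by
    have h1 : 1 + 1 / 2 * Real.log ρ2U ≤ -1 := by linarith only [hlog]
    have h2 : 0 < pL / W := by positivity
    nlinarith only [h1, h2, hpW]
  have hB : k * (T + 1 / 2) / (2 * W) ≤ 101 / 500 * b := by
    rw [div_le_iff₀ (by positivity)]
    have h1 : k * (T + 1 / 2) ≤ 2 / 5 * b * T * (101 / 100 * T) :=
      mul_le_mul hk (by linarith only [hT50]) (by linarith only [hT0]) (by positivity)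
    nlinarith only [h1, mul_le_mul_of_nonneg_left hW1 hb0.le]
  have hX : pL / W * (1 + 1 / 2 * Real.log ρ2U) + k * (T + 1 / 2) / (2 * W) ≤ -6 := by
    have h1 : 31.8 * (101 / 500 * b + 6) ≤ T := by nlinarith only [hT, hb]
    have h2 : 101 / 500 * b + 6 ≤ T / 31.8 := by rw [le_div_iff₀ (by norm_num)]; linarith only [h1]
    linarith only [hA, hB, h2]
  have hE : Real.exp (pL / W * (1 + 1 / 2 * Real.log ρ2U) + k * (T + 1 / 2) / (2 * W)) ≤ 1 / 398 := by
    refine (Real.exp_le_exp.2 hX).trans ?_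
    rw [Real.exp_neg, inv_le_comm₀ (Real.exp_pos _) (by norm_num)]
    have h6 : Real.exp 6 = Real.exp 4 * Real.exp 2 := by rw [← Real.exp_add]; norm_num
    rw [h6]; norm_num; nlinarith only [exp_numerics.2.2.2, exp_numerics.2.1, Real.exp_pos 2]
  nlinarith only [hE, hρ2le, Real.exp_pos (pL / W * (1 + 1 / 2 * Real.log ρ2U) + k * (T + 1 / 2) / (2 * W))]

/-- `η ≤ 2/25`. [this track, ATTEMPT-19 §8 (P5)] -/
theorem eta_le {b L T k pL W ηU : ℝ} {N₁ : ℕ} (hb : 100 ≤ b) (hL0 : 0 < L) (hL2 : L ≤ 2 * b + 1)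
    (hT : 110000 * (b + 1) ^ 2 ≤ T) (hk0 : 0 ≤ k) (hW0 : 0 < W) (hW2 : W ≤ 101 / 100 * T ^ 2)
    (hpL : T ^ 3 / 31.42 ≤ pL) (hν : k * (T + 1 / 2) / pL ≤ 1 / 100) (hN₁le : (N₁ : ℝ) ≤ 4 * L + 4)
    (hηU : ηU = Real.exp (2 * (1 / pL + k * (T + 1 / 2) / pL ^ 2) * W * (N₁ : ℝ) ^ 2) - 1) : ηU ≤ 2 / 25 := by
  have hT0 : 0 < T := by nlinarith only [hb, hT]
  have hpL0 : 0 < pL := lt_of_lt_of_le (by positivity) hpL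
  rw [hηU]
  set u := 2 * (1 / pL + k * (T + 1 / 2) / pL ^ 2) * W * (N₁ : ℝ) ^ 2 with hu
  have hu0 : 0 ≤ u := by positivity
  have hinner : 1 / pL + k * (T + 1 / 2) / pL ^ 2 ≤ 101 / 100 / pL := by
    have e : 1 / pL + k * (T + 1 / 2) / pL ^ 2 = (1 + k * (T + 1 / 2) / pL) / pL := by
      field_simp
    rw [e]; exact div_le_div_of_nonneg_right (by linarith only [hν]) hpL0.le
  have hu1 : u ≤ 1 / 25 := by
    have h1 : u ≤ 2 * (101 / 100 / pL) * (101 / 100 * T ^ 2) * (4 * L + 4) ^ 2 := by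
      rw [hu]
      have a1 : 2 * (1 / pL + k * (T + 1 / 2) / pL ^ 2) * W ≤ 2 * (101 / 100 / pL) * (101 / 100 * T ^ 2) :=
        mul_le_mul (by linarith only [hinner]) hW2 hW0.le (by positivity)
      have a2 : (N₁ : ℝ) ^ 2 ≤ (4 * L + 4) ^ 2 := pow_le_pow_left₀ (by positivity) hN₁le 2
      exact mul_le_mul a1 a2 (by positivity) (by positivity)
    have h2 : 2 * (101 / 100 / pL) * (101 / 100 * T ^ 2) * (4 * L + 4) ^ 2 ≤ 1 / 25 := by
      have e : 2 * (101 / 100 / pL) * (101 / 100 * T ^ 2) * (4 * L + 4) ^ 2 =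
          2 * (101 / 100) * (101 / 100) * 16 * (T ^ 2 * (L + 1) ^ 2) / pL := by
        field_simp; ring
      rw [e, div_le_iff₀ hpL0]
      have h3 : 26000 * (L + 1) ^ 2 ≤ T := by nlinarith only [hT, hb, hL2, hL0]
      have h3' := mul_le_mul_of_nonneg_right h3 (sq_nonneg T)
      have h4 : T ^ 3 ≤ 31.42 * pL := by rw [div_le_iff₀ (by norm_num)] at hpL; linarith only [hpL]
      nlinarith only [h3', h4, sq_nonneg T, sq_nonneg (L + 1)]
    linarith only [h1, h2]
  have := Real.abs_exp_sub_one_le (x := u) (by rw [abs_of_nonneg hu0]; linarith only [hu1])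
  rw [abs_of_nonneg hu0] at this
  have := (abs_le.1 this).2
  linarith only [this, hu1]

/-- **The profile-control constants (ATTEMPT-19 §8 (P5)).** In the abstract variables of the module docstring:
`N₁+1 ≤ pL/(2W)`, `ρ₁ < 1`, `ρ₂ ≤ e^{-2}`, `1/2 ≤ κ`. [this track, ATTEMPT-19 §8 (P5)] -/
theorem profile_constants {b L T k pL W y lamU ρ1 ρ2U ηU τ1 τ2U κ : ℝ} {N₁ : ℕ}
    (hb : 100 ≤ b) (hL1 : 2 * b ≤ L) (hL2 : L ≤ 2 * b + 1)
    (hTe : Real.exp (2 * b) ≤ T) (hW1 : T ^ 2 ≤ W) (hW2 : W ≤ 101 / 100 * T ^ 2) (hk0 : 2 ≤ k) (hk : k ≤ 2 / 5 * b * T)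
    (hpL : T ^ 3 / (10 * π) ≤ pL)
    (hy : y = 3 / 5 * (L * Real.sqrt L)) (hN₁ : N₁ = 4 * ⌈L⌉₊)
    (hlamU : lamU = 1 + k * (T + 1 / 2) / pL)
    (hρ1 : ρ1 = Real.exp (3 + lamU) * (4 * y ^ 2) / (4 * ((N₁ : ℝ) + 1) ^ 3))
    (hρ2U : ρ2U = 8 * Real.exp 2 * W ^ 3 * y ^ 2 / pL ^ 3)
    (hηU : ηU = Real.exp (2 * (1 / pL + k * (T + 1 / 2) / pL ^ 2) * W * (N₁ : ℝ) ^ 2) - 1)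
    (hτ1 : τ1 = ρ1 ^ (N₁ + 1) / (1 - ρ1))
    (hτ2U : τ2U = Real.exp (pL / W * (1 + 1 / 2 * Real.log ρ2U) + k * (T + 1 / 2) / (2 * W)) / (1 - ρ2U))
    (hκ : κ = 1 - ηU - 3 * τ1 - τ2U) :
    (N₁ : ℝ) + 1 ≤ pL / (2 * W) ∧ ρ1 < 1 ∧ ρ2U ≤ Real.exp (-2) ∧ 1 / 2 ≤ κ := by
  have hπ4 : π < 3.142 := by have := Real.pi_lt_d4; linarith only [this]
  have hT := horizon_master hb hTe
  have hT0 : 0 < T := by nlinarith only [hT, hb]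
  have hL0 : 0 < L := by linarith only [hL1, hb]
  have hW0 : 0 < W := lt_of_lt_of_le (by positivity) hW1
  have hk00 : 0 ≤ k := by linarith only [hk0]
  have hpL' : T ^ 3 / 31.42 ≤ pL :=
    le_trans (div_le_div_of_nonneg_left (by positivity) (by positivity) (by linarith only [hπ4])) hpL
  have hpL0 : 0 < pL := lt_of_lt_of_le (by positivity) hpL'
  have hy2 : y ^ 2 = 9 / 25 * L ^ 3 := by rw [hy, mul_pow, mul_pow, Real.sq_sqrt hL0.le]; ring
  have hN₁le : (N₁ : ℝ) ≤ 4 * L + 4 := by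
    rw [hN₁]; push_cast
    have := Nat.ceil_lt_add_one hL0.le
    linarith only [this]
  have hN₁ge : 4 * L ≤ (N₁ : ℝ) := by
    rw [hN₁]; push_cast
    have := Nat.le_ceil L
    linarith only [this]
  have hν := nu_le hb hT hk hpL'
  have hν0 : 0 ≤ k * (T + 1 / 2) / pL := by positivity
  have hN := N_le hb hL2 hT hW0 hW2 hpL' hN₁le
  rw [hy2] at hρ1 hρ2U
  have hρ1le := rho1_le (ν := k * (T + 1 / 2) / pL) hL0 hν0 hν hlamU rfl hN₁ge hρ1
  have hρ1ge : 0 ≤ ρ1 := by rw [hρ1]; positivity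
  have h5 : 5 ≤ N₁ + 1 := by
    have : (5 : ℝ) ≤ (N₁ : ℝ) + 1 := by linarith only [hN₁ge, hL1, hb]
    exact_mod_cast this
  have hτ1le := tau1_le hρ1ge hρ1le h5 hτ1
  have hρ2le := rho2_le hb hL0 hL2 hT hW0 hW2 hpL' hρ2U
  have hρ2ge : 0 < ρ2U := by rw [hρ2U]; positivity
  have hρ2e : ρ2U ≤ Real.exp (-2) := by
    refine hρ2le.trans ?_
    rw [Real.exp_neg, le_inv_comm₀ (by norm_num) (Real.exp_pos _)]
    have := exp_numerics.1; norm_num; linarith only [this]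
  have hτ2le := tau2_le hb hT hk hW1 hW2 hpL' hρ2ge hρ2le hτ2U
  have hηle := eta_le hb hL0 hL2 hT hk00 hW0 hW2 hpL' hν hN₁le hηU
  refine ⟨hN, by linarith only [hρ1le], hρ2e, ?_⟩
  rw [hκ]; linarith only [hηle, hτ1le, hτ2le]

end Summit.RiemannHypothesis.RiemannHypothesis.Theorems.Handoff
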